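import Literature.LinearAlgebra.CMSurfacePairCocharacterDichotomy
import Mathlib.GroupTheory.Perm.Cycle.Type
import Mathlib.LinearAlgebra.FiniteDimensional.Lemmas
import Mathlib.Data.Int.Order.Units
import HarnessLib

/-!
# The cocharacter splitting behind Moonen–Zarhin 1999, (5.10) with `d_min = 2`: a `ℤ`-spanned subspace of `A₁ × A₂`
# (`A₁ ≅ ℂ³` the Lie algebra of the norm-one torus of a SEXTIC CM field read on its six eigenlines, `A₂ ≅ ℂ²` that of a
# QUARTIC one on its four) projecting onto both factors, with a TRANSITIVE Galois symmetry on the six lines and a 4-CYCLE on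
# the four, is ALL of `A₁ × A₂`

Layer `Literature/LinearAlgebra`, namespace `Literature.LinearAlgebra.CMThreefoldSurface`; lane `lit-hodgefound` (Track 2
foundations library), prover seat `lit-hodgefound-p17` (generation 55, self-proposed row g55-#10).  PURE LINEAR ALGEBRA on
`ℂ^{ι₁ ⊕ ι₂}` — no Hodge theory, no tori; THEOREMS ONLY (no definition, no instance, no notation, no named fact; D-0026 net debt
0).  The consumer (`Literature/Geometry/Kaehler/ComplexTorusSimpleCMThreefoldTimesCMSurfaceHodgeGroup`, g55-#12) instantiates it
on `L = {z | P diag(z) P⁻¹ ∈ Lie Hg(T × S)(ℂ)}` for a simple complex abelian THREEFOLD `T` and a simple complex abelian SURFACE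
`S`, both with complex multiplication, read in common eigenframes `P = P₁ ⊕ P₂` of `End⁰(T) ⊗ ℂ`, `End⁰(S) ⊗ ℂ` — the companion
of the tree's `CMSurfacePairCocharacterDichotomy` (g53-#1, two surfaces).

## Source, verbatim, and what is abstracted

B. Moonen, Yu. G. Zarhin, *Hodge classes on abelian varieties of low dimension*, Math. Ann. **315** (1999) 711–733, held
`paper:arxiv-math_9901113`, §5 (5.10) (materialised text p0010 L18–L45): «First suppose that `d_min = 2`. Then `X ∼ Y₁ × Y₂`
where `Y₁` is a simple abelian surface and `Y₂` is a simple abelian threefold. Note that `Y₁` is of CM-type with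
`Hg(Y₁) = U_{F₁}` […] If `Y₂` is of CM-type then `F₂ = End⁰(Y₂)` is a sextic CM-field. By Lemma (3.6) and Lemma (3.7), we can
have `Hg(X) ≠ Hg(Y₁) × Hg(Y₂)` only if `F₂` contains an imaginary quadratic field `k` such that `U_{F₁}` is isogenous to
`SU_{F₂/k}`. Suppose this is the case. Write `Ω₁` for the normal closure of `F₁` over `ℚ`. Either `Ω₁ = F₁` and
`Gal(Ω₁/ℚ) = ℤ/4ℤ` (as `F₁` does not contain an imaginary quadratic field), or `Ω₁` has degree 8 over `ℚ`. […] The Galois group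
`Gal(k·Ω₂/ℚ)` is either `(ℤ/2ℤ) × 𝔖₃` or `(ℤ/2ℤ) × (ℤ/3ℤ)`. […] The assumption that `U_{F₁}` is isogenous to `SU_{F₂/k}` thus
implies that `Ω₁ ⊆ k·Ω₂`. Looking at Galois groups we obtain a contradiction. Hence again `Hg(X) = Hg(Y₁) × Hg(Y₂)`.»

Here, as in g53-#1, the torus-theoretic content is isolated as linear algebra on cocharacters.  Block 1 (`ι₁`, `#ι₁ = 6`)
carries the six eigenlines of `End⁰(T) ⊗ ℂ` paired by the fixed-point-free involution `π₁`, block 2 (`ι₂`, `#ι₂ = 4`) the four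
eigenlines of `End⁰(S) ⊗ ℂ` paired by `π₂`; `Aᵢ = {πᵢ-antisymmetric vectors} = Lie U_{Fᵢ}(ℂ)`; `L = Lie Hg(T × S)(ℂ) ⊆ A₁ × A₂`
projects onto both factors, is spanned by INTEGER vectors (`Lie = X_* ⊗ ℂ`), and is carried to itself by the eigenline
permutations of every `σ ∈ Aut(ℂ)` — among which: a 4-CYCLE on block 2 (the quartic CM field of a SIMPLE CM surface contains no
imaginary quadratic field, Moonen–Zarhin (4.1), the tree's g53-#2), and a family TRANSITIVE on block 1 (`F₂` is a field, so
`Aut(ℂ)` is transitive on its complex embeddings).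

DEVIATION FROM THE PRINT (recorded).  Moonen–Zarhin compare the Galois groups of the normal closures `Ω₁` and `k·Ω₂`.  Here the
hypothetical isogeny `U_{F₁} ∼ SU_{F₂/k}` is excluded by a PARITY count on the eigenlines instead: if `L` projected
isomorphically onto `A₁` (the alternative left by the tree's kernel dichotomy `CMSurfacePair.forall_eq_zero_or_forall_elim_mem`),
the kernel of `L ↠ A₂` would be a line `ℂ·v` with `v` rational of FULL support (transitivity), the square `h²` of the block-1
component `h` of the 4-cycle symmetry would act on `A₁/ℂv ≅ A₂` as `-1`, forcing `e_j - e_{π₁ j} + e_{h⁻²j} - e_{π₁ h⁻² j} ∈ ℂ·v`,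
hence `= 0` (support `≤ 4 < 6`), i.e. `h² = π₁` — but `π₁`, a product of three disjoint transpositions, is an ODD permutation and
`h²` is even.  (This is the `[F₂ : ℚ] = 6` versus «order 4 or 8» of the printed Galois-group comparison.)

## What is proved (all hypotheses explicit; `z (inl j)`, `z (inr m)` are the two blocks of `z : ι₁ ⊕ ι₂ → ℂ`)

* §0 `sign_eq_neg_one_of_forall_ne` (a fixed-point-free involution of a 6-set is odd; private corollary: it is not a
  square), `finrank_antisymm_le_three` (`dim A₁ ≤ 3` from a sign vector exchanging antisymmetric and symmetric vectors).
* §1 **`false_of_forall_eq_zero`** — THE PARITY STEP: under the hypotheses above, `L` cannot project injectively to block 1.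
* §2 **`forall_mem`** — THE SPLITTING: `L = A₁ × A₂`.

## References

* [MoonenZarhin1999LowDim] B. Moonen, Yu. G. Zarhin, Math. Ann. 315 (1999), §5 (5.10), §3 Lemma (3.6)–(3.7), §4 (4.1).
* [Borel1991] A. Borel, *Linear Algebraic Groups*, 2nd ed., AG §14.2 (Galois descent of subspaces), §8.11 (`k`-tori).
* [Springer1998] T. A. Springer, *Linear Algebraic Groups*, 2nd ed., 3.2.10 (4), 4.4.13 (`Lie T = k ⊗ X_*(T)`), 13.1.1.
-/

noncomputable section

open Function Module

namespace Literature.LinearAlgebra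

namespace CMThreefoldSurface

open CMSurfacePair (four_points ringEquiv_comp_mem_of_le_span_int exists_rat_ne_zero_of_forall_ringEquiv
  forall_eq_zero_or_forall_elim_mem forall_mem_of_forall_elim_mem)

/-! ### §0 Parity of a fixed-point-free involution of six points; the dimension of the antisymmetric vectors -/

section Parity

variable {ι : Type*} [Fintype ι] [DecidableEq ι]

/-- **A fixed-point-free involution of a 6-element set is an odd permutation** (three disjoint transpositions).
[folklore] [cite: MoonenZarhin1999LowDim, §5 (5.10) (`[F₂ : ℚ] = 6`)] -/
theorem sign_eq_neg_one_of_forall_ne (hcard : Fintype.card ι = 6) (π : Equiv.Perm ι) (hπ2 : π * π = 1)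
    (hπ' : ∀ j, π j ≠ j) : Equiv.Perm.sign π = -1 := by
  have hsupp : π.support = Finset.univ := Finset.eq_univ_of_forall fun j ↦ Equiv.Perm.mem_support.2 (hπ' j)
  have hct := Equiv.Perm.cycleType_of_pow_prime_eq_one (p := 2) (σ := π) (by rw [pow_two]; exact hπ2)
  have hsum := Equiv.Perm.sum_cycleType π
  rw [hsupp, Finset.card_univ, hcard, hct, Multiset.sum_replicate, smul_eq_mul] at hsum
  have hc : Multiset.card π.cycleType = 3 := by omega
  rw [Equiv.Perm.sign_of_cycleType, hct, Multiset.sum_replicate, Multiset.card_replicate, hc]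
  decide

/-- **… hence it is not the square of a permutation.** [folklore] -/
private theorem mul_self_ne_of_forall_ne (hcard : Fintype.card ι = 6) (π : Equiv.Perm ι) (hπ2 : π * π = 1) (hπ' : ∀ j, π j ≠ j)
    (h : Equiv.Perm ι) : h * h ≠ π := fun he ↦ by
  have hs := congrArg Equiv.Perm.sign he
  rw [Equiv.Perm.sign_mul, Int.units_mul_self, sign_eq_neg_one_of_forall_ne hcard π hπ2 hπ'] at hs
  exact absurd hs (by decide)

omit [DecidableEq ι] in
/-- **`dim {π-antisymmetric vectors} ≤ 3` on six points** carrying a nowhere-zero `π`-antisymmetric vector `s` (the CM type):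
`w ↦ s·w` maps antisymmetric vectors injectively to symmetric ones, and the two subspaces meet in `0`. [folklore]
[cite: Springer1998, 13.1.1 (`dim U = ½ [F : ℚ]`)] -/
theorem finrank_antisymm_le_three (hcard : Fintype.card ι = 6) (π : ι → ι) {s : ι → ℂ} (hs0 : ∀ j, s j ≠ 0)
    (hsπ : ∀ j, s (π j) = -s j) :
    finrank ℂ (LinearMap.ker (LinearMap.funLeft ℂ ℂ π + LinearMap.id) : Submodule ℂ (ι → ℂ)) ≤ 3 := by
  set A : Submodule ℂ (ι → ℂ) := LinearMap.ker (LinearMap.funLeft ℂ ℂ π + LinearMap.id) with hA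
  set S : Submodule ℂ (ι → ℂ) := LinearMap.ker (LinearMap.funLeft ℂ ℂ π - LinearMap.id) with hS
  have hmemA : ∀ w, w ∈ A ↔ ∀ j, w (π j) = -w j := fun w ↦ by
    simp only [hA, LinearMap.mem_ker, LinearMap.add_apply, LinearMap.id_apply, funext_iff, Pi.add_apply,
      LinearMap.funLeft_apply, Pi.zero_apply, eq_neg_iff_add_eq_zero]
  have hmemS : ∀ w, w ∈ S ↔ ∀ j, w (π j) = w j := fun w ↦ by
    simp only [hS, LinearMap.mem_ker, LinearMap.sub_apply, LinearMap.id_apply, funext_iff, LinearMap.funLeft_apply,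
      sub_eq_zero]
  obtain ⟨μ, hμ⟩ : ∃ μ : (ι → ℂ) →ₗ[ℂ] (ι → ℂ), ∀ w j, μ w j = s j * w j :=
    ⟨{ toFun := fun w j ↦ s j * w j
       map_add' := fun w w' ↦ by funext j; simp [mul_add]
       map_smul' := fun c w ↦ by funext j; simp [mul_left_comm] }, fun _ _ ↦ rfl⟩
  have hμinj : Injective μ := fun w w' h ↦ by
    funext j
    have hj := congrFun h j
    rw [hμ, hμ] at hj
    exact mul_left_cancel₀ (hs0 j) hj
  have hmap : A.map μ ≤ S := by
    rintro _ ⟨w, hw, rfl⟩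
    rw [hmemS]
    intro j
    rw [hμ, hμ, hsπ, (hmemA w).1 hw j, neg_mul_neg]
  have hinf : A ⊓ S = ⊥ := by
    rw [eq_bot_iff]
    intro w hw
    rw [Submodule.mem_bot]
    funext j
    have h1 := (hmemA w).1 hw.1 j
    rw [(hmemS w).1 hw.2 j] at h1
    exact self_eq_neg.1 h1
  have h1 : finrank ℂ A ≤ finrank ℂ S :=
    (LinearEquiv.finrank_eq (Submodule.equivMapOfInjective μ hμinj A)).le.trans (Submodule.finrank_mono hmap)
  have h2 := Submodule.finrank_sup_add_finrank_inf_eq A S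
  rw [hinf, finrank_bot, add_zero] at h2
  have h3 : finrank ℂ (A ⊔ S : Submodule ℂ (ι → ℂ)) ≤ 6 := by
    rw [← hcard, ← Module.finrank_fintype_fun_eq_card (R := ℂ) (η := ι)]
    exact Submodule.finrank_le _
  omega

end Parity

/-! ### §1 The parity step: `L` cannot project injectively to the threefold block -/

section ParityStep

variable {ι₁ ι₂ : Type*} [Fintype ι₁] [DecidableEq ι₁] [Fintype ι₂] [DecidableEq ι₂] {L : Submodule ℂ (ι₁ ⊕ ι₂ → ℂ)}

/-- **THE PARITY STEP.**  `L ⊆ ℂ^{ι₁ ⊕ ι₂}` (`#ι₁ = 6`, `#ι₂ = 4`) `ℤ`-spanned, antisymmetric in both blocks, projecting ONTO the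
antisymmetric vectors of both blocks, block 1 carrying a nowhere-zero antisymmetric (sign) vector, carried into itself by a symmetry
`(h, g)` with `g` the 4-cycle `m₀ ↦ m₀' ↦ π₂ m₀` and `h` a permutation of block 1, and by a family of symmetries
`(e, e₂)` (`e` commuting with `π₁`) TRANSITIVE on `ι₁` — then the projection of `L` to block 1 is NOT injective.  [Were it
injective: `dim L ≤ 3`, the kernel of `L ↠ A₂` is a line `ℂ v` (`v` rational by Galois descent, of full support by transitivity);
`z ↦ z ∘ (h, g)² + z` maps `L` into that kernel (`g² = π₂`), so `e_j - e_{π₁ j} + (e_j - e_{π₁ j}) ∘ h² ∈ ℂ v` has support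
`≤ 4 < 6`, hence vanishes: `h² = π₁`, contradicting the parity of `π₁`.]
[cite: MoonenZarhin1999LowDim, §5 (5.10) (p0010 L24–L45), §3 Lemma (3.6)–(3.7)] [cite: Borel1991, AG §14.2 and §8.11] -/
theorem false_of_forall_eq_zero (hcard₁ : Fintype.card ι₁ = 6) (hcard₂ : Fintype.card ι₂ = 4)
    {π₁ : ι₁ → ι₁} (hπ₁ : Involutive π₁) (hπ₁' : ∀ j, π₁ j ≠ j) {π₂ : ι₂ → ι₂} (hπ₂ : Involutive π₂)
    {s : ι₁ → ℂ} (hs0 : ∀ j, s j ≠ 0) (hsπ : ∀ j, s (π₁ j) = -s j)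
    {t : ι₂ → ℂ} (ht : ∀ m, t (π₂ m) = -t m) {m₀ m₀' : ι₂} (hm : m₀ ≠ m₀') (ht₀ : t m₀ = 1) (ht₀' : t m₀' = 1)
    (hL₁ : ∀ z ∈ L, ∀ j, z (.inl (π₁ j)) = -z (.inl j)) (hL₂ : ∀ z ∈ L, ∀ m, z (.inr (π₂ m)) = -z (.inr m))
    (hsurj₁ : ∀ w : ι₁ → ℂ, (∀ j, w (π₁ j) = -w j) → ∃ z ∈ L, ∀ j, z (.inl j) = w j)
    (hsurj₂ : ∀ w : ι₂ → ℂ, (∀ m, w (π₂ m) = -w m) → ∃ z ∈ L, ∀ m, z (.inr m) = w m)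
    (hint : L ≤ Submodule.span ℂ {z | z ∈ L ∧ ∀ x, ∃ n : ℤ, z x = n})
    (h : Equiv.Perm ι₁) {g : ι₂ → ι₂} (hstab : ∀ z ∈ L, z ∘ Sum.map h g ∈ L)
    (hgπ : ∀ m, g (π₂ m) = π₂ (g m)) (hg₀ : g m₀ = m₀') (hg₀' : g m₀' = π₂ m₀)
    (htrans : ∀ j j' : ι₁, ∃ (e : Equiv.Perm ι₁) (e₂ : ι₂ → ι₂), (∀ z ∈ L, z ∘ Sum.map e e₂ ∈ L) ∧
      (∀ k, e (π₁ k) = π₁ (e k)) ∧ e j = j')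
    (hK : ∀ z ∈ L, (∀ j, z (.inl j) = 0) → z = 0) : False := by
  classical
  obtain ⟨⟨h1, h2, h3, h4, h5⟩, hex⟩ := four_points hcard₂ hπ₂ ht hm ht₀ ht₀'
  -- `g² = π₂`
  have hg2 : ∀ m, g (g m) = π₂ m := fun m ↦ by
    rcases hex m with rfl | rfl | rfl | rfl
    · rw [hg₀, hg₀']
    · rw [hg₀', hgπ, hg₀]
    · rw [hgπ, hg₀, hgπ, hg₀', hπ₂]
    · rw [hgπ, hg₀', hπ₂, hg₀, hπ₂]
  -- the antisymmetric unit vectors `d j = e_j - e_{π₁ j}` of block 1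
  obtain ⟨d, hd⟩ : ∃ d : ι₁ → ι₁ → ℂ, ∀ j k, d j k = if k = j then 1 else if k = π₁ j then -1 else 0 :=
    ⟨_, fun _ _ ↦ rfl⟩
  have hdπ : ∀ j k, d j (π₁ k) = -d j k := fun j k ↦ by
    by_cases hk1 : k = j
    · rw [hk1]; simp [hd, hπ₁' j]
    · by_cases hk2 : k = π₁ j
      · rw [hk2, hπ₁ j]; simp [hd, hπ₁' j]
      · have hk3 : π₁ k ≠ j := fun h' ↦ hk2 (by rw [← h', hπ₁ k])
        have hk4 : π₁ k ≠ π₁ j := fun h' ↦ hk1 (hπ₁.injective h')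
        simp [hd, hk1, hk2, hk3, hk4]
  -- the key consequence of `d j ∘ h² + d j = 0`: `h² j = π₁ j`
  have hkey : ∀ j, (∀ k, d j (h (h k)) + d j k = 0) → h (h j) = π₁ j := fun j hj ↦ by
    have hk := hj (h.symm (h.symm (π₁ j)))
    rw [Equiv.apply_symm_apply, Equiv.apply_symm_apply, hdπ, hd j j, if_pos rfl, neg_add_eq_zero] at hk
    -- `d j k = 1` forces `k = j`
    have hkj : h.symm (h.symm (π₁ j)) = j := by
      by_contra hne
      rw [hd] at hk
      rw [if_neg hne] at hk
      split_ifs at hk <;> norm_num at hk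
    have := congrArg (fun x ↦ h (h x)) hkj
    simpa only [Equiv.apply_symm_apply] using this.symm
  -- for every `j`, the vector `Y j = (d j ∘ h² + d j, 0)` lies in `L`
  have hY : ∀ j, ∃ y ∈ L, (∀ k, y (.inl k) = d j (h (h k)) + d j k) ∧ ∀ m, y (.inr m) = 0 := fun j ↦ by
    obtain ⟨z, hzL, hz⟩ := hsurj₁ (d j) (hdπ j)
    refine ⟨(z ∘ Sum.map h g) ∘ Sum.map h g + z, L.add_mem (hstab _ (hstab z hzL)) hzL, fun k ↦ ?_, fun m ↦ ?_⟩
    · simp only [Pi.add_apply, comp_apply, Sum.map_inl, hz]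
    · simp only [Pi.add_apply, comp_apply, Sum.map_inr, hg2, hL₂ z hzL, neg_add_cancel]
  -- it suffices that every `Y j` vanishes (then `h² = π₁`, an odd permutation)
  suffices hall : ∀ j k, d j (h (h k)) + d j k = 0 by
    refine mul_self_ne_of_forall_ne hcard₁ (hπ₁.toPerm π₁) (Equiv.ext fun j ↦ ?_) (fun j ↦ ?_) h (Equiv.ext fun j ↦ ?_)
    · simp [hπ₁ j]
    · simpa using hπ₁' j
    · simpa using hkey j (hall j)
  by_contra hne
  push Not at hne
  obtain ⟨j₁, k₁, hjk₁⟩ := hne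
  obtain ⟨y₁, hy₁L, hy₁, hy₁0⟩ := hY j₁
  have hy₁ne : y₁ ≠ 0 := fun h0 ↦ hjk₁ (by rw [← hy₁ k₁, h0, Pi.zero_apply])
  -- (i) the kernel `V = {z ∈ L | z|₂ = 0}` is `Aut(ℂ)`-stable: a non-zero rational vector `w`
  let V : Submodule ℂ (ι₁ ⊕ ι₂ → ℂ) := L ⊓ LinearMap.ker (LinearMap.funLeft ℂ ℂ (Sum.inr : ι₂ → ι₁ ⊕ ι₂))
  have hV : ∀ y, y ∈ V ↔ y ∈ L ∧ ∀ m, y (.inr m) = 0 := by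
    intro y
    simp only [V, Submodule.mem_inf, LinearMap.mem_ker, funext_iff, LinearMap.funLeft_apply, Pi.zero_apply]
  have hVst : ∀ σ : ℂ ≃+* ℂ, ∀ v ∈ V, (⇑σ ∘ v) ∈ V := by
    intro σ v hv
    rw [hV] at hv ⊢
    exact ⟨ringEquiv_comp_mem_of_le_span_int hint σ hv.1, fun m ↦ by rw [comp_apply, hv.2 m, map_zero]⟩
  obtain ⟨w, hwV, hw0, hwq⟩ := exists_rat_ne_zero_of_forall_ringEquiv V hVst ((hV y₁).2 ⟨hy₁L, hy₁0⟩) hy₁ne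
  obtain ⟨hwL, hw2⟩ := (hV w).1 hwV
  -- (ii) dimensions: `dim L ≤ 3`, `L ↠ A₂ ⊇ {d m₀, d m₀'}`, so the kernel of the block-2 projection is a line
  set q₁ : L →ₗ[ℂ] (ι₁ → ℂ) := (LinearMap.funLeft ℂ ℂ (Sum.inl : ι₁ → ι₁ ⊕ ι₂)).comp L.subtype with hq₁
  set q₂ : L →ₗ[ℂ] (ι₂ → ℂ) := (LinearMap.funLeft ℂ ℂ (Sum.inr : ι₂ → ι₁ ⊕ ι₂)).comp L.subtype with hq₂
  have hq₁a : ∀ (y : L) j, q₁ y j = (y : ι₁ ⊕ ι₂ → ℂ) (.inl j) := fun _ _ ↦ rfl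
  have hq₂a : ∀ (y : L) m, q₂ y m = (y : ι₁ ⊕ ι₂ → ℂ) (.inr m) := fun _ _ ↦ rfl
  have hq₁inj : Injective q₁ := fun y y' hyy ↦ by
    apply Subtype.ext
    have h0 := hK _ (L.sub_mem y.2 y'.2) fun j ↦ by
      have hj := congrFun hyy j
      rw [hq₁a, hq₁a] at hj
      rw [Pi.sub_apply, hj, sub_self]
    exact sub_eq_zero.1 h0
  have hA₁ : LinearMap.range q₁ ≤ LinearMap.ker (LinearMap.funLeft ℂ ℂ π₁ + LinearMap.id) := by
    rintro _ ⟨y, rfl⟩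
    simp only [LinearMap.mem_ker, LinearMap.add_apply, LinearMap.id_apply, funext_iff, Pi.add_apply, LinearMap.funLeft_apply,
      Pi.zero_apply, hq₁a]
    exact fun j ↦ by rw [hL₁ _ y.2 j, neg_add_cancel]
  have hdimL : finrank ℂ L ≤ 3 := by
    rw [← LinearMap.finrank_range_of_inj hq₁inj]
    exact (Submodule.finrank_mono hA₁).trans (finrank_antisymm_le_three hcard₁ π₁ hs0 hsπ)
  -- two independent vectors in the range of `q₂`
  obtain ⟨d₂, hd₂⟩ : ∃ d₂ : ι₂ → ι₂ → ℂ, ∀ m k, d₂ m k = if k = m then 1 else if k = π₂ m then -1 else 0 :=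
    ⟨_, fun _ _ ↦ rfl⟩
  have hd₂π : ∀ m k, d₂ m (π₂ k) = -d₂ m k := fun m k ↦ by
    have hπm : π₂ m ≠ m := by
      rcases hex m with rfl | rfl | rfl | rfl
      · exact h1
      · exact h4
      · rw [hπ₂]; exact h1.symm
      · rw [hπ₂]; exact h4.symm
    by_cases hk1 : k = m
    · rw [hk1]; simp [hd₂, hπm]
    · by_cases hk2 : k = π₂ m
      · rw [hk2, hπ₂ m]; simp [hd₂, hπm]
      · have hk3 : π₂ k ≠ m := fun h' ↦ hk2 (by rw [← h', hπ₂ k])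
        have hk4 : π₂ k ≠ π₂ m := fun h' ↦ hk1 (hπ₂.injective h')
        simp [hd₂, hk1, hk2, hk3, hk4]
  obtain ⟨z₀, hz₀L, hz₀⟩ := hsurj₂ (d₂ m₀) (hd₂π m₀)
  obtain ⟨z₀', hz₀'L, hz₀'⟩ := hsurj₂ (d₂ m₀') (hd₂π m₀')
  have hli : LinearIndependent ℂ ![(⟨q₂ ⟨z₀, hz₀L⟩, LinearMap.mem_range_self _ _⟩ : LinearMap.range q₂),
      (⟨q₂ ⟨z₀', hz₀'L⟩, LinearMap.mem_range_self _ _⟩ : LinearMap.range q₂)] := by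
    rw [LinearIndependent.pair_iff]
    intro a b hab
    have hab' := congrArg (fun v : LinearMap.range q₂ ↦ (v : ι₂ → ℂ)) hab
    simp only [Submodule.coe_add, Submodule.coe_smul_of_tower, Submodule.coe_zero] at hab'
    have hm₀ := congrFun hab' m₀
    have hm₀' := congrFun hab' m₀'
    simp only [Pi.add_apply, Pi.smul_apply, smul_eq_mul, hq₂a, hz₀, hz₀', hd₂, Pi.zero_apply, if_neg hm,
      if_neg hm.symm, if_neg h1.symm, if_neg h3.symm, if_neg h2.symm] at hm₀ hm₀'
    simp only [ite_true, mul_one, mul_zero, add_zero, zero_add] at hm₀ hm₀'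
    exact ⟨hm₀, hm₀'⟩
  have hdimR : 2 ≤ finrank ℂ (LinearMap.range q₂) := by
    simpa using hli.fintype_card_le_finrank
  have hrn := LinearMap.finrank_range_add_finrank_ker q₂
  have hdimK : finrank ℂ (LinearMap.ker q₂) ≤ 1 := by omega
  -- (iii) the kernel is the line through `w`
  have hline : ∀ y ∈ L, (∀ m, y (.inr m) = 0) → ∃ c : ℂ, y = c • w := by
    have hwk : (⟨w, hwL⟩ : L) ∈ LinearMap.ker q₂ := by
      rw [LinearMap.mem_ker]; funext m; rw [hq₂a]; exact hw2 m
    have hwne : (⟨⟨w, hwL⟩, hwk⟩ : LinearMap.ker q₂) ≠ 0 := fun h0 ↦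
      hw0 (by simpa using congrArg (fun v : LinearMap.ker q₂ ↦ ((v : L) : ι₁ ⊕ ι₂ → ℂ)) h0)
    have hpos : 0 < finrank ℂ (LinearMap.ker q₂) :=
      (finrank_pos_iff_exists_ne_zero (R := ℂ) (M := LinearMap.ker q₂)).2 ⟨_, hwne⟩
    have hone : finrank ℂ (LinearMap.ker q₂) = 1 := le_antisymm hdimK hpos
    intro y hyL hy2
    have hyk : (⟨y, hyL⟩ : L) ∈ LinearMap.ker q₂ := by
      rw [LinearMap.mem_ker]; funext m; rw [hq₂a]; exact hy2 m
    obtain ⟨c, hc⟩ := (finrank_eq_one_iff_of_nonzero' (K := ℂ) (V := LinearMap.ker q₂) _ hwne).1 hone ⟨⟨y, hyL⟩, hyk⟩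
    refine ⟨c, ?_⟩
    have h' := congrArg (fun v : LinearMap.ker q₂ ↦ ((v : L) : ι₁ ⊕ ι₂ → ℂ)) hc
    simp only [SetLike.val_smul] at h'
    exact h'.symm
  -- (iv) `w` has full support on block 1 (transitivity)
  obtain ⟨j₀, hj₀⟩ : ∃ j, w (.inl j) ≠ 0 := by
    by_contra hnone
    push Not at hnone
    exact hw0 (funext fun x ↦ by rcases x with j | m <;> simp [hnone, hw2])
  have hfull : ∀ j, w (.inl j) ≠ 0 := fun j ↦ by
    obtain ⟨e, e₂, he, -, hej⟩ := htrans j j₀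
    obtain ⟨c, hc⟩ := hline _ (he w hwL) fun m ↦ by rw [comp_apply, Sum.map_inr, hw2]
    have hj := congrFun hc (.inl j)
    rw [comp_apply, Sum.map_inl, hej, Pi.smul_apply, smul_eq_mul] at hj
    intro h0
    rw [h0, mul_zero] at hj
    exact hj₀ hj
  -- (v) every `Y j` is a multiple of `w` with support `≤ 4 < 6`, hence zero
  refine hjk₁ ?_
  obtain ⟨c, hc⟩ := hline y₁ hy₁L hy₁0
  -- a coordinate outside `{j₁, π₁ j₁, h⁻² j₁, h⁻² (π₁ j₁)}`
  obtain ⟨k₀, hk₀⟩ : ∃ k₀ : ι₁, k₀ ∉ ({j₁, π₁ j₁, h.symm (h.symm j₁), h.symm (h.symm (π₁ j₁))} : Finset ι₁) := by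
    by_contra hno
    push Not at hno
    have hle : (Finset.univ : Finset ι₁).card ≤ ({j₁, π₁ j₁, h.symm (h.symm j₁), h.symm (h.symm (π₁ j₁))} : Finset ι₁).card :=
      Finset.card_le_card fun k _ ↦ hno k
    rw [Finset.card_univ, hcard₁] at hle
    have h4' : ({j₁, π₁ j₁, h.symm (h.symm j₁), h.symm (h.symm (π₁ j₁))} : Finset ι₁).card ≤ 4 := Finset.card_le_four
    omega
  simp only [Finset.mem_insert, Finset.mem_singleton, not_or] at hk₀
  obtain ⟨hk₁', hk₂', hk₃', hk₄'⟩ := hk₀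
  have hk₃'' : h (h k₀) ≠ j₁ := fun h' ↦ hk₃' (by rw [← h', Equiv.symm_apply_apply, Equiv.symm_apply_apply])
  have hk₄'' : h (h k₀) ≠ π₁ j₁ := fun h' ↦ hk₄' (by rw [← h', Equiv.symm_apply_apply, Equiv.symm_apply_apply])
  have hc0 : c = 0 := by
    have hk := congrFun hc (.inl k₀)
    rw [hy₁, Pi.smul_apply, smul_eq_mul, hd, hd, if_neg hk₃'', if_neg hk₄'', if_neg hk₁', if_neg hk₂', add_zero] at hk
    exact (mul_eq_zero.1 hk.symm).resolve_right (hfull k₀)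
  have hk := congrFun hc (.inl k₁)
  rw [hy₁, hc0, zero_smul, Pi.zero_apply] at hk
  exact hk

end ParityStep

/-! ### §2 The splitting -/

section Splitting

variable {ι₁ ι₂ : Type*} [Fintype ι₁] [DecidableEq ι₁] [Fintype ι₂] [DecidableEq ι₂] {L : Submodule ℂ (ι₁ ⊕ ι₂ → ℂ)}

/-- **THE COCHARACTER SPLITTING FOR A CM THREEFOLD × A CM SURFACE: `L = A₁ × A₂`.**  Hypotheses as in `false_of_forall_eq_zero`
(`#ι₁ = 6` with fixed-point-free involution `π₁` and a sign vector; `#ι₂ = 4` with `π₂` and a CM type `{m₀, m₀'}`; `L`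
`ℤ`-spanned, antisymmetric, projecting onto both blocks; a symmetry `(h, g)` with `g` the 4-cycle; a transitive family on block
1); conclusion: every vector antisymmetric in both blocks lies in `L` — «Hence again `Hg(X) = Hg(Y₁) × Hg(Y₂)`».  By the tree's
kernel dichotomy (g53-#1) either `0 × A₂ ⊆ L` — then `L = A₁ × A₂` — or `L` projects injectively to block 1, excluded by §1.
[cite: MoonenZarhin1999LowDim, §5 (5.10) (p0010 L24–L45), §3 Lemma (3.6)–(3.7), §4 (4.1)] [cite: Borel1991, AG §14.2 and §8.11]
[cite: Springer1998, 3.2.10 (4) and 4.4.13] -/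
theorem forall_mem (hcard₁ : Fintype.card ι₁ = 6) (hcard₂ : Fintype.card ι₂ = 4)
    {π₁ : ι₁ → ι₁} (hπ₁ : Involutive π₁) (hπ₁' : ∀ j, π₁ j ≠ j) {π₂ : ι₂ → ι₂} (hπ₂ : Involutive π₂)
    {s : ι₁ → ℂ} (hs0 : ∀ j, s j ≠ 0) (hsπ : ∀ j, s (π₁ j) = -s j)
    {t : ι₂ → ℂ} (ht : ∀ m, t (π₂ m) = -t m) {m₀ m₀' : ι₂} (hm : m₀ ≠ m₀') (ht₀ : t m₀ = 1) (ht₀' : t m₀' = 1)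
    (hL₁ : ∀ z ∈ L, ∀ j, z (.inl (π₁ j)) = -z (.inl j)) (hL₂ : ∀ z ∈ L, ∀ m, z (.inr (π₂ m)) = -z (.inr m))
    (hsurj₁ : ∀ w : ι₁ → ℂ, (∀ j, w (π₁ j) = -w j) → ∃ z ∈ L, ∀ j, z (.inl j) = w j)
    (hsurj₂ : ∀ w : ι₂ → ℂ, (∀ m, w (π₂ m) = -w m) → ∃ z ∈ L, ∀ m, z (.inr m) = w m)
    (hint : L ≤ Submodule.span ℂ {z | z ∈ L ∧ ∀ x, ∃ n : ℤ, z x = n})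
    (h : Equiv.Perm ι₁) {g : ι₂ → ι₂} (hstab : ∀ z ∈ L, z ∘ Sum.map h g ∈ L)
    (hgπ : ∀ m, g (π₂ m) = π₂ (g m)) (hg₀ : g m₀ = m₀') (hg₀' : g m₀' = π₂ m₀)
    (htrans : ∀ j j' : ι₁, ∃ (e : Equiv.Perm ι₁) (e₂ : ι₂ → ι₂), (∀ z ∈ L, z ∘ Sum.map e e₂ ∈ L) ∧
      (∀ k, e (π₁ k) = π₁ (e k)) ∧ e j = j')
    (z : ι₁ ⊕ ι₂ → ℂ) (hz₁ : ∀ j, z (.inl (π₁ j)) = -z (.inl j)) (hz₂ : ∀ m, z (.inr (π₂ m)) = -z (.inr m)) :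
    z ∈ L := by
  rcases forall_eq_zero_or_forall_elim_mem hcard₂ hπ₂ ht hm ht₀ ht₀' hL₂ hint (g₁ := ⇑h) hstab hgπ hg₀ hg₀' with hK | hfull
  · exact (false_of_forall_eq_zero hcard₁ hcard₂ hπ₁ hπ₁' hπ₂ hs0 hsπ ht hm ht₀ ht₀' hL₁ hL₂ hsurj₁ hsurj₂ hint h hstab hgπ hg₀
      hg₀' htrans hK).elim
  · exact forall_mem_of_forall_elim_mem hL₂ hsurj₁ hfull z hz₁ hz₂

end Splitting

end CMThreefoldSurface

end Literature.LinearAlgebra
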